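import Summits.BirchSwinnertonDyer.BirchSwinnertonDyer.Theorems.AdditivePotSupersingularRankOneTowerSurjOfKato
import Summits.BirchSwinnertonDyer.BirchSwinnertonDyer.Theorems.KatoDescentPotSupersingularWildUpperHeegnerTwist
import HarnessLib

/-!
# K9's residual `WildRankOne` (stmt-BirchSwinnertonDyer-19200) on the TOWER-SURJECTIVE rows, in the item's own binders:
# the LOWER half of BSD₃ is the Eisenstein ♭-inclusion away from print; BSD₃ is the ♭-IMC equality (or X + Ko) + K9's
# r = 0 LOWER half `WildLowerHalfRankZero` (in its own text) away from print

Prover seat `bsd-potss-kmc`, gen 20 (cell `bsd-potss`; row B8 «O7-ss», wild part = class O6 at `3`; K9 route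
`KatoDescentPotSupersingular`, residual 19200; the onto cell of the W-ALL leaf is routes UTD/SOED's), 2026-08-27. HONEST FRAMING:
CONDITIONAL on every displayed hypothesis; 0 definitions, 0 named facts minted, 0 `sorry`; closes nothing; BSD₃ for no curve.

On the wild X4 rows with `3`-adic TOWER surjectivity (`AdditiveThree.TowerSurjThree W`: `ρ_{E,3^n}` onto for every `n ≥ 1` — the
binder of SOED's Kolyvagin items; NOT implied by `ρ̄_{E,3}` onto, Elkies), gen 20's pieces — control from facts
(`additiveControl_heegner_potSS_of_facts_of_serre1967`), the row-local half kernels with odd-discriminant twist binders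
(`…RowKernelsOddTwist.lean`), the twist's r = 0 UPPER half from Kato A161″ (`missingUpperBoundAt_twist_of_towerSurj_of_katoTam`) —
read in K9's binders `r_an = 1 → ClassO6 W 3` (plus `TowerSurjThree W` and a free row predicate `R`):

* `forall_hasSurjectiveModNGaloisRep_pow_three_of_towerSurjThree` — `TowerSurjThree W` ⟹ `∀ n, ρ̄_{E,3^n}` onto (level `3⁰` trivial);
* **`missingLowerBoundAt_wildRankOne_towerSurj_of_flatEisenstein_of_katoTam_of_facts`** — the r = 1 LOWER half
  `MissingLowerBoundAt W 3` ⟸ the Eisenstein ♭-inclusion X on the class rows (RESEARCH — at the wild `3` this is route SOED's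
  crux `WildSplitEisensteinInclusionAtThree` 20479 in ♭-currency) ∧ Kato A161″ ∧ {Poitou–Tate ×2, local Euler–Poincaré,
  cd ≤ 2, Brink Thm 2 / Cor 1, Serre 1967} ∧ Hsieh ∧ LZZ ∧ ToricPublishedInputs;
* **`bsdp_wildRankOne_towerSurj_of_flatIMCEq_of_wildLowerHalfRankZero_of_katoTam_of_facts`** — `BSD₃(E)` ⟸ the ♭-IMC
  equality on the class rows ∧ **K9's L₀ in its own text** (`∀ W, r_an = 0 → ClassO6 W 3 → MissingLowerBoundAt W 3` = the decl
  `WildLowerHalfRankZero`, stated verbatim so that K9's route file is not imported; the twist `E^{(d_K)}` is again on `ClassO6`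
  by `classO6_twist_of_heegner`) ∧ A161″ ∧ the same facts; `missingPPartAt_…` in 19200's currency.

NET for the K9 tenure: on the tower-onto wild X4 rank-one rows, 19200's LOWER half = {X♭} + print; 19200 = {IMC♭-eq} + L₀ +
print. No `p`-adic height, no signed Selmer condition, no twin.

References: [Kato2004Asterisque] Thm. 14.5 (3), Prop. 14.16 (2), §14.8; [GreenbergLNM1716] Prop. 4.13; [GrossZagier1986] I.(6.3),
Thm. I.7.3; [JetchevSkinnerWan2017] §7.4.1, Thm. 3.3.1; [Hsieh2014] Thm A; [LiuZhangZhang2018] Thm 1.5.1/1.5.3; [SilvermanATAEC1994]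
IV.9.4; [Serre1967GroupesPDivisibles] §5 Prop. 8; [Brink2007] Thm 2, Cor 1; [GrossLMS1991] §1.
-/

noncomputable section

open scoped Classical

set_option linter.dupNamespace false
set_option autoImplicit false

namespace Summit.BirchSwinnertonDyer.BirchSwinnertonDyer.Theorems.UniversalToricDescentWaldspurgerFlat

open WeierstrassCurve NumberField IsDedekindDomain Field PowerSeries
  Literature.NumberTheory.EllipticCurves
  Literature.NumberTheory.EllipticCurves.ModularForms
  Literature.NumberTheory.EllipticCurves.Rank1Residual
  Literature.NumberTheory.EllipticCurves.Rank1Residual.Typed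
  Literature.NumberTheory.EllipticCurves.KrizLi2019
  Literature.NumberTheory.GaloisRepresentations
  Literature.NumberTheory.GaloisCohomology
  Summit.BirchSwinnertonDyer.Rank1Residual
  Summit.BirchSwinnertonDyer.Rank1Residual.Additive
  Summit.BirchSwinnertonDyer.Rank1Residual.X11b
  Summit.BirchSwinnertonDyer.Rank1Residual.X11b.AcSelmer
  Summit.BirchSwinnertonDyer.Rank1Residual.X11b.Halves
  Summit.BirchSwinnertonDyer.Rank1Residual.X11b.CongruenceLimit
  Summit.BirchSwinnertonDyer.BirchSwinnertonDyer.Theses.UniversalToricDescent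
  Summit.BirchSwinnertonDyer.BirchSwinnertonDyer.Theorems.AdditivePotSupersingularControl

/-! ## §1 Tower surjectivity in K9/SOED's spelling -/

/-- `AdditiveThree.TowerSurjThree W` (`ρ_{E,3^n}` onto for every `n ≥ 1`) gives `ρ̄_{E,3^n}` onto for EVERY `n : ℕ` — the
level-`3⁰` case is the trivial group (as in the tree's proof of Serre's tower lemma). [cite: GrossLMS1991, §1] -/
theorem forall_hasSurjectiveModNGaloisRep_pow_three_of_towerSurjThree (W : WeierstrassCurve ℚ) [W.IsElliptic]
    (hT : AdditiveThree.TowerSurjThree W) : ∀ n : ℕ, W.HasSurjectiveModNGaloisRep (3 ^ n : ℕ) := by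
  intro n
  cases n with
  | zero =>
    haveI : Subsingleton (geomTorsion W ((3 ^ 0 : ℕ) : ℤ)) := ⟨fun a b ↦ by
      have ha := AddSubgroup.torsionBy.nsmul_iff.mp a.2
      have hb := AddSubgroup.torsionBy.nsmul_iff.mp b.2
      simp only [pow_zero, one_smul] at ha hb
      exact Subtype.ext (ha.trans hb.symm)⟩
    intro y
    exact ⟨1, Multiplicative.toAdd.injective (AddEquiv.ext fun a ↦ Subsingleton.elim _ _)⟩
  | succ k => exact_mod_cast hT (k + 1) k.succ_pos

section WildThree

variable [Fact (3 : ℕ).Prime] (R : WeierstrassCurve ℚ → Prop)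

/-! ## §2 The r = 1 LOWER half of 19200 on the tower-surjective rows: ONE research input -/

/-- **The LOWER half of K9's `WildRankOne` on the TOWER-SURJECTIVE rows from the Eisenstein ♭-inclusion alone (modulo
print)**, in the item's binders: for any row predicate `R`, on `r_an = 1`, `ClassO6 W 3`, `TowerSurjThree W`, `R W`:
`MissingLowerBoundAt W 3` ⟸ `hIncl` (X on the class rows — at the wild `3` route SOED's crux X in ♭-currency) ∧ A161″ ∧ the
seven cohomological facts ∧ Hsieh ∧ LZZ ∧ ToricPublishedInputs. CONDITIONAL; closes nothing.
[cite: JetchevSkinnerWan2017, §7.4.1 and Thm. 3.3.1 (arXiv:1512.06894)] [cite: Kato2004Asterisque, Thm. 14.5 (3), Prop. 14.16 (2)]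
[cite: Serre1967GroupesPDivisibles, §5 Prop. 8] [cite: GrossZagier1986, I.(6.3)] -/
theorem missingLowerBoundAt_wildRankOne_towerSurj_of_flatEisenstein_of_katoTam_of_facts
    (hA : Hsieh2014.thmA_exists_isHsiehLFunction_unrPeriod_anyLevel)
    (hL : LiuZhangZhang2018.thm151_thm153_modularCurve_heegnerVector_additive)
    (hF : ToricPublishedInputs)
    (hKatoT : Kato2004.rankZero_padicValNat_sha_add_padicValNat_tamagawa_le_of_additive_potGood_of_imageContainsSL2)
    (hPT : ∀ (K : Type) [Field K] [NumberField K], poitouTate_selmerStructure_duality K)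
    (hPT2 : ∀ (K : Type) [Field K] [NumberField K], poitouTate_sha_tateDual K)
    (hEP : ∀ (K : Type) [Field K] [NumberField K] (v : HeightOneSpectrum (𝓞 K)),
      localEulerPoincareCharacteristic (v.adicCompletion K))
    (hcd : fieldCdLE_two_of_numberField)
    (hBr : ∀ (K : Type) [Field K] [NumberField K] (p : ℕ) [Fact p.Prime],
      ZpExtension.decomp_not_le_kerSubgroup_of_isAnticyclotomic K p)
    (hBr2 : ∀ (K : Type) [Field K] [NumberField K] (p : ℕ) [Fact p.Prime],
      ZpExtension.decomp_not_le_kerSubgroup_above_of_isAnticyclotomic K p)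
    (hS : Serre1967.noStableDivisibleLine_of_potentiallySupersingular)
    (hIncl : ∀ (W : WeierstrassCurve ℚ) [W.IsElliptic] [W.IsGloballyMinimal] (N : ℕ) [NeZero N] (K : Type) [Field K]
      [NumberField K] (Dt : ModularParametrizationData W N),
      R W → ClassO6 W 3 → AdditiveThree.TowerSurjThree W → W.analyticRank = 1 →
      W.conductorNorm ℤ = N → IsImaginaryQuadratic K → SatisfiesHeegnerHypothesis N K →
      ∀ (κ : ZpExtension K 3), κ.IsAnticyclotomic → ∀ (γ : Field.absoluteGaloisGroup K) [Fact (κ.IsTopGenerator γ)]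
        (𝔭 : HeightOneSpectrum (𝓞 K)), ((3 : ℕ) : 𝓞 K) ∈ 𝔭.asIdeal → 𝔭.asIdeal.ramificationIdx (𝓞 ℚ) = 1 →
        𝔭.asIdeal.inertiaDeg (𝓞 ℚ) = 1 → ∀ (𝔭' : HeightOneSpectrum (𝓞 K)), ((3 : ℕ) : 𝓞 K) ∈ 𝔭'.asIdeal → 𝔭' ≠ 𝔭 →
        ∀ (ι' : PadicAlgCl 3 ≃+* ℂ), SchneiderFree.BranchInducesPrime 3 ι' 𝔭 →
        ∀ (ΩK : ℂ) (Ωp : ℂ_[3]) (Q : PowerSeries (PadicComplexInt 3)), ΩK ≠ 0 → Ωp ≠ 0 →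
          R1.IsBDPLFunctionInt 3 ι' 𝔭 κ γ Dt.f ΩK Ωp Q →
          (XAc.charIdeal (W.baseChange K) 3 κ 𝔭' ∅ γ).map (PowerSeries.map (R1.toCpInt 3)) ≤ Ideal.span {Q}) :
    ∀ (W : WeierstrassCurve ℚ) [W.IsElliptic] [W.IsGloballyMinimal], W.analyticRank = 1 → ClassO6 W 3 →
      AdditiveThree.TowerSurjThree W → R W → MissingLowerBoundAt W 3 := by
  intro W _ _ hr hO6 hT hR
  have hsurj := forall_hasSurjectiveModNGaloisRep_pow_three_of_towerSurjThree W hT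
  have haddv : Addv W 3 := hO6.2.1
  have hj : 0 ≤ padicValRat 3 W.j := hO6.padicValRat_j_nonneg
  have hirr : W.HasIrreducibleModPGaloisRep 3 := by
    have h1 := hsurj 1
    simp only [pow_one] at h1
    haveI : NeZero ((3 : ℕ) : ℚ) := ⟨by norm_num⟩
    exact hasIrreducibleModPGaloisRep_of_hasSurjectiveModNGaloisRep W 3 (by exact_mod_cast h1)
  have hGZK : rank_eq_analyticRank_of_analyticRank_le_one := hF.2.2.1
  have hmod : hasEntireLFunction_rat := hF.2.2.2.1
  exact missingLowerBoundAt_of_flatEisenstein_of_control_of_twistUpper_row 3 (by decide) hA hL hF W haddv hr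
    (fun N _ K _ _ Dt hN hK hHN κ hκ γ _ 𝔭 h𝔭 he hf 𝔭' h𝔭' hne ι' hind ΩK Ωp Q hΩK hΩp hBDP ↦
      hIncl W N K Dt hR hO6 hT hr hN hK hHN κ hκ γ 𝔭 h𝔭 he hf 𝔭' h𝔭' hne ι' hind ΩK Ωp Q hΩK hΩp hBDP)
    (fun N _ K _ _ Dt H ι P hN hK hHN _hLt hP hnt hKo κ hκ γ _ 𝔭 h𝔭 he hf ↦
      additiveControl_heegner_potSS_of_facts_of_serre1967 hPT hPT2 hEP hcd hBr hBr2 hS 3 W N K Dt H ι P (Or.inr hO6) hirr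
        hN hK hHN hP hnt hKo κ hκ γ 𝔭 h𝔭 he hf)
    (fun N _ K _ _ Wd _ _ hN hK hHN hC hLt ↦
      missingUpperBoundAt_twist_of_towerSurj_of_katoTam 3 (by decide) hKatoT hGZK hmod W haddv hj hsurj hN K hK hHN Wd hC hLt)

/-! ## §3 BSD₃ on the tower-surjective rows of 19200: the IMC + K9's r = 0 LOWER half in its own text -/

/-- **K9's `WildRankOne` on the TOWER-SURJECTIVE rows from the ♭-IMC equality and `WildLowerHalfRankZero` (modulo print).**
For any row predicate `R`, on `r_an = 1`, `ClassO6 W 3`, `TowerSurjThree W`, `R W`: `BSDp W 3` ⟸ `hEq` (the ♭-(∅,0)-IMC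
equality on the class rows — RESEARCH) ∧ `hL0` (K9's crux L₀ `WildLowerHalfRankZero` VERBATIM: `∀ W, r_an = 0 → ClassO6 W 3 →
MissingLowerBoundAt W 3` — RESEARCH; consumed at the twist `E^{(d_K)}`, which is again wild at `3` with `r_an = 0` by
`classO6_twist_of_heegner`) ∧ A161″ ∧ the seven cohomological facts ∧ Hsieh ∧ LZZ ∧ ToricPublishedInputs. The twist's UPPER half
and the local control are NOT hypotheses. CONDITIONAL; closes nothing; BSD₃ for no curve.
[cite: JetchevSkinnerWan2017, §7.4.1 and Thm. 3.3.1 (arXiv:1512.06894)] [cite: Kato2004Asterisque, Thm. 14.5 (3), Prop. 14.16 (2)]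
[cite: SilvermanATAEC1994, IV.9.4 (PDF pp. 344–346)] [cite: Serre1967GroupesPDivisibles, §5 Prop. 8] [cite: GrossZagier1986, I.(6.3) and Thm. I.7.3] -/
theorem bsdp_wildRankOne_towerSurj_of_flatIMCEq_of_wildLowerHalfRankZero_of_katoTam_of_facts
    (hA : Hsieh2014.thmA_exists_isHsiehLFunction_unrPeriod_anyLevel)
    (hL : LiuZhangZhang2018.thm151_thm153_modularCurve_heegnerVector_additive)
    (hF : ToricPublishedInputs)
    (hKatoT : Kato2004.rankZero_padicValNat_sha_add_padicValNat_tamagawa_le_of_additive_potGood_of_imageContainsSL2)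
    (hPT : ∀ (K : Type) [Field K] [NumberField K], poitouTate_selmerStructure_duality K)
    (hPT2 : ∀ (K : Type) [Field K] [NumberField K], poitouTate_sha_tateDual K)
    (hEP : ∀ (K : Type) [Field K] [NumberField K] (v : HeightOneSpectrum (𝓞 K)),
      localEulerPoincareCharacteristic (v.adicCompletion K))
    (hcd : fieldCdLE_two_of_numberField)
    (hBr : ∀ (K : Type) [Field K] [NumberField K] (p : ℕ) [Fact p.Prime],
      ZpExtension.decomp_not_le_kerSubgroup_of_isAnticyclotomic K p)
    (hBr2 : ∀ (K : Type) [Field K] [NumberField K] (p : ℕ) [Fact p.Prime],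
      ZpExtension.decomp_not_le_kerSubgroup_above_of_isAnticyclotomic K p)
    (hS : Serre1967.noStableDivisibleLine_of_potentiallySupersingular)
    (hEq : ∀ (W : WeierstrassCurve ℚ) [W.IsElliptic] [W.IsGloballyMinimal] (N : ℕ) [NeZero N] (K : Type) [Field K]
      [NumberField K] (Dt : ModularParametrizationData W N),
      R W → ClassO6 W 3 → AdditiveThree.TowerSurjThree W → W.analyticRank = 1 →
      W.conductorNorm ℤ = N → IsImaginaryQuadratic K → SatisfiesHeegnerHypothesis N K →
      ∀ (κ : ZpExtension K 3), κ.IsAnticyclotomic → ∀ (γ : Field.absoluteGaloisGroup K) [Fact (κ.IsTopGenerator γ)]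
        (𝔭 : HeightOneSpectrum (𝓞 K)), ((3 : ℕ) : 𝓞 K) ∈ 𝔭.asIdeal → 𝔭.asIdeal.ramificationIdx (𝓞 ℚ) = 1 →
        𝔭.asIdeal.inertiaDeg (𝓞 ℚ) = 1 → ∀ (𝔭' : HeightOneSpectrum (𝓞 K)), ((3 : ℕ) : 𝓞 K) ∈ 𝔭'.asIdeal → 𝔭' ≠ 𝔭 →
        ∀ (ι' : PadicAlgCl 3 ≃+* ℂ), SchneiderFree.BranchInducesPrime 3 ι' 𝔭 →
        ∀ (ΩK : ℂ) (Ωp : ℂ_[3]) (Q : PowerSeries (PadicComplexInt 3)), ΩK ≠ 0 → Ωp ≠ 0 →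
          R1.IsBDPLFunctionInt 3 ι' 𝔭 κ γ Dt.f ΩK Ωp Q →
          (XAc.charIdeal (W.baseChange K) 3 κ 𝔭' ∅ γ).map (PowerSeries.map (R1.toCpInt 3)) = Ideal.span {Q})
    (hL0 : ∀ (W : WeierstrassCurve ℚ) [W.IsElliptic] [W.IsGloballyMinimal] [Fact (3 : ℕ).Prime], W.analyticRank = 0 →
      ClassO6 W 3 → MissingLowerBoundAt W 3) :
    ∀ (W : WeierstrassCurve ℚ) [W.IsElliptic] [W.IsGloballyMinimal], W.analyticRank = 1 → ClassO6 W 3 →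
      AdditiveThree.TowerSurjThree W → R W → BSDp W 3 := by
  intro W _ _ hr hO6 hT hR
  have hsurj := forall_hasSurjectiveModNGaloisRep_pow_three_of_towerSurjThree W hT
  have haddv : Addv W 3 := hO6.2.1
  have hj : 0 ≤ padicValRat 3 W.j := hO6.padicValRat_j_nonneg
  have hirr : W.HasIrreducibleModPGaloisRep 3 := by
    have h1 := hsurj 1
    simp only [pow_one] at h1
    haveI : NeZero ((3 : ℕ) : ℚ) := ⟨by norm_num⟩
    exact hasIrreducibleModPGaloisRep_of_hasSurjectiveModNGaloisRep W 3 (by exact_mod_cast h1)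
  have hGZK : rank_eq_analyticRank_of_analyticRank_le_one := hF.2.2.1
  have hmod : hasEntireLFunction_rat := hF.2.2.2.1
  have hKo : ∀ (N : ℕ) [NeZero N] (W : WeierstrassCurve ℚ) (K : Type) [Field K] [NumberField K],
      Literature.NumberTheory.EllipticCurves.kolyvagin N W K := hF.2.1
  have hCtl : ∀ (N : ℕ) [NeZero N] (K : Type) [Field K] [NumberField K] (Dt : ModularParametrizationData W N)
      (H : HeegnerDatum N (NumberField.discr K)) (ι : K →+* ℂ) (P : (W.baseChange K).toAffine.Point),
      W.conductorNorm ℤ = N → IsImaginaryQuadratic K → SatisfiesHeegnerHypothesis N K →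
      WeierstrassCurve.Affine.Point.map ι.toRatAlgHom P = heegnerPointComplex Dt H → ¬ IsOfFinAddOrder P →
      Literature.NumberTheory.EllipticCurves.kolyvagin N W K →
      ∀ (κ : ZpExtension K 3), κ.IsAnticyclotomic → ∀ (γ : Field.absoluteGaloisGroup K) [Fact (κ.IsTopGenerator γ)]
        (𝔭 : HeightOneSpectrum (𝓞 K)) (h𝔭 : ((3 : ℕ) : 𝓞 K) ∈ 𝔭.asIdeal) (he : 𝔭.asIdeal.ramificationIdx (𝓞 ℚ) = 1)
        (hf : 𝔭.asIdeal.inertiaDeg (𝓞 ℚ) = 1), SchneiderFree.AdditiveControlOnTreeAt 3 κ 𝔭 γ (embAt K 3 𝔭 h𝔭 he hf) P :=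
    fun N _ K _ _ Dt H ι P hN hK hHN hP hnt hKo' κ hκ γ _ 𝔭 h𝔭 he hf ↦
      additiveControl_heegner_potSS_of_facts_of_serre1967 hPT hPT2 hEP hcd hBr hBr2 hS 3 W N K Dt H ι P (Or.inr hO6) hirr
        hN hK hHN hP hnt hKo' κ hκ γ 𝔭 h𝔭 he hf
  refine bsdp_of_indexHalves_of_twistHalvesOdd_row 3 (by decide) hF W haddv hr ?_ ?_ ?_ ?_
  · intro N _ K _ _ Dt H ι P hN hK hHN _hodd hd4 _hLt hP hnt
    exact indexLowerBoundLeAt_of_flatInclLe_of_control (by decide) hA hL Dt H ι P haddv hN hK hHN hd4 hP hnt (hKo N W K)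
      (fun κ hκ γ _ 𝔭 h𝔭 he hf 𝔭' h𝔭' hne ι' hind ΩK Ωp Q hΩK hΩp hBDP ↦
        (hEq W N K Dt hR hO6 hT hr hN hK hHN κ hκ γ 𝔭 h𝔭 he hf 𝔭' h𝔭' hne ι' hind ΩK Ωp Q hΩK hΩp hBDP).le)
      (fun κ hκ γ _ 𝔭 h𝔭 he hf ↦ hCtl N K Dt H ι P hN hK hHN hP hnt (hKo N W K) κ hκ γ 𝔭 h𝔭 he hf)
  · intro N _ K _ _ Dt H ι P hN hK hHN _hodd hd4 _hLt hP hnt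
    exact indexUpperBoundLeAt_of_flatInclGe_of_control (by decide) hA hL Dt H ι P haddv hN hK hHN hd4 hP hnt (hKo N W K)
      (fun κ hκ γ _ 𝔭 h𝔭 he hf 𝔭' h𝔭' hne ι' hind ΩK Ωp Q hΩK hΩp hBDP ↦
        (hEq W N K Dt hR hO6 hT hr hN hK hHN κ hκ γ 𝔭 h𝔭 he hf 𝔭' h𝔭' hne ι' hind ΩK Ωp Q hΩK hΩp hBDP).ge)
      (fun κ hκ γ _ 𝔭 h𝔭 he hf ↦ hCtl N K Dt H ι P hN hK hHN hP hnt (hKo N W K) κ hκ γ 𝔭 h𝔭 he hf)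
  · -- the twist's r = 0 LOWER half: K9's L₀ at `Wd`, a wild row of analytic rank `0`
    intro N _ K _ _ Wd _ _ hN hK hHN hodd _hd4 hC hLt
    obtain ⟨Cd, hCd⟩ := hC
    have hHN' : SatisfiesHeegnerHypothesis (W.conductorNorm ℤ) K := hN ▸ hHN
    obtain ⟨hO6d, -⟩ := classO6_twist_of_heegner W hO6 K hK hHN' hodd Wd Cd hCd
    have hD0 : (NumberField.discr K : ℚ) ≠ 0 := by exact_mod_cast NumberField.discr_ne_zero K
    haveI : (W.quadraticTwist (NumberField.discr K : ℚ)).IsElliptic := W.isElliptic_quadraticTwist hD0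
    have hLd1 : Wd.entireLFunction 1 ≠ 0 := by rw [← hCd, entireLFunction_smul]; exact hLt
    exact hL0 Wd (analyticRank_eq_zero_of_entireLFunction_one_ne_zero Wd hLd1) hO6d
  · intro N _ K _ _ Wd _ _ hN hK hHN _hodd _hd4 hC hLt
    exact missingUpperBoundAt_twist_of_towerSurj_of_katoTam 3 (by decide) hKatoT hGZK hmod W haddv hj hsurj hN K hK hHN Wd
      hC hLt

/-- **The same in 19200's currency `MissingPPartAt W 3`** (`Ш(E/ℚ)` finite by GZK). CONDITIONAL; closes nothing (19200 is
class-wide and declared residual; this is its reduction on the tower-onto rows to ONE analytic statement + K9's L₀).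
[cite: JetchevSkinnerWan2017, §7.4.1 (arXiv:1512.06894 p. 30)] [cite: Kato2004Asterisque, Thm. 14.5 (3), Prop. 14.16 (2)] -/
theorem missingPPartAt_wildRankOne_towerSurj_of_flatIMCEq_of_wildLowerHalfRankZero_of_katoTam_of_facts
    (hA : Hsieh2014.thmA_exists_isHsiehLFunction_unrPeriod_anyLevel)
    (hL : LiuZhangZhang2018.thm151_thm153_modularCurve_heegnerVector_additive)
    (hF : ToricPublishedInputs)
    (hKatoT : Kato2004.rankZero_padicValNat_sha_add_padicValNat_tamagawa_le_of_additive_potGood_of_imageContainsSL2)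
    (hPT : ∀ (K : Type) [Field K] [NumberField K], poitouTate_selmerStructure_duality K)
    (hPT2 : ∀ (K : Type) [Field K] [NumberField K], poitouTate_sha_tateDual K)
    (hEP : ∀ (K : Type) [Field K] [NumberField K] (v : HeightOneSpectrum (𝓞 K)),
      localEulerPoincareCharacteristic (v.adicCompletion K))
    (hcd : fieldCdLE_two_of_numberField)
    (hBr : ∀ (K : Type) [Field K] [NumberField K] (p : ℕ) [Fact p.Prime],
      ZpExtension.decomp_not_le_kerSubgroup_of_isAnticyclotomic K p)
    (hBr2 : ∀ (K : Type) [Field K] [NumberField K] (p : ℕ) [Fact p.Prime],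
      ZpExtension.decomp_not_le_kerSubgroup_above_of_isAnticyclotomic K p)
    (hS : Serre1967.noStableDivisibleLine_of_potentiallySupersingular)
    (hEq : ∀ (W : WeierstrassCurve ℚ) [W.IsElliptic] [W.IsGloballyMinimal] (N : ℕ) [NeZero N] (K : Type) [Field K]
      [NumberField K] (Dt : ModularParametrizationData W N),
      R W → ClassO6 W 3 → AdditiveThree.TowerSurjThree W → W.analyticRank = 1 →
      W.conductorNorm ℤ = N → IsImaginaryQuadratic K → SatisfiesHeegnerHypothesis N K →
      ∀ (κ : ZpExtension K 3), κ.IsAnticyclotomic → ∀ (γ : Field.absoluteGaloisGroup K) [Fact (κ.IsTopGenerator γ)]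
        (𝔭 : HeightOneSpectrum (𝓞 K)), ((3 : ℕ) : 𝓞 K) ∈ 𝔭.asIdeal → 𝔭.asIdeal.ramificationIdx (𝓞 ℚ) = 1 →
        𝔭.asIdeal.inertiaDeg (𝓞 ℚ) = 1 → ∀ (𝔭' : HeightOneSpectrum (𝓞 K)), ((3 : ℕ) : 𝓞 K) ∈ 𝔭'.asIdeal → 𝔭' ≠ 𝔭 →
        ∀ (ι' : PadicAlgCl 3 ≃+* ℂ), SchneiderFree.BranchInducesPrime 3 ι' 𝔭 →
        ∀ (ΩK : ℂ) (Ωp : ℂ_[3]) (Q : PowerSeries (PadicComplexInt 3)), ΩK ≠ 0 → Ωp ≠ 0 →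
          R1.IsBDPLFunctionInt 3 ι' 𝔭 κ γ Dt.f ΩK Ωp Q →
          (XAc.charIdeal (W.baseChange K) 3 κ 𝔭' ∅ γ).map (PowerSeries.map (R1.toCpInt 3)) = Ideal.span {Q})
    (hL0 : ∀ (W : WeierstrassCurve ℚ) [W.IsElliptic] [W.IsGloballyMinimal] [Fact (3 : ℕ).Prime], W.analyticRank = 0 →
      ClassO6 W 3 → MissingLowerBoundAt W 3) :
    ∀ (W : WeierstrassCurve ℚ) [W.IsElliptic] [W.IsGloballyMinimal], W.analyticRank = 1 → ClassO6 W 3 →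
      AdditiveThree.TowerSurjThree W → R W → MissingPPartAt W 3 := by
  intro W _ _ hr hO6 hT hR
  have hGZK : rank_eq_analyticRank_of_analyticRank_le_one := hF.2.2.1
  haveI : Finite W.sha := (hGZK W (by omega)).2
  exact missingPPartAt_of_bsdp W 3
    (bsdp_wildRankOne_towerSurj_of_flatIMCEq_of_wildLowerHalfRankZero_of_katoTam_of_facts R hA hL hF hKatoT hPT hPT2 hEP hcd
      hBr hBr2 hS hEq hL0 W hr hO6 hT hR)

end WildThree

end Summit.BirchSwinnertonDyer.BirchSwinnertonDyer.Theorems.UniversalToricDescentWaldspurgerFlat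

end
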